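import Summits.QuantumFields.YangMills.Theses.PencilRigidity
import Summits.QuantumFields.YangMills.Theses.MirrorModularBoosts
import Literature.MathematicalPhysics.QuantumFieldTheory.YangMillsOS

/-!
# Crux `DiagonalMirrorRPR` (stmt-QuantumFields-10604), line `parity-bridge-cold-traces`, stub `stub_rpClosure`:
# vocabulary and frames

Part of the proof of the registered stub `stub_rpClosure` (S4) of the skeleton
`Cruxes/DiagonalMirrorRPR/Lines/parity_bridge_cold_traces.lean` (crux `DiagonalMirrorRPR`, stmt-QuantumFields-10604,
routes `PencilRigidity` = `MirrorModularBoosts`), split by topic over the modules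
`…StubRpClosureDefs` (vocabulary, frames) ← `…StubRpClosureLattice` (swap on the cover, expectations, lattice Gram
positivity), `…StubRpClosureSupport` (support bookkeeping, test functions) and `…StubRpClosureDensity` (ordered-wedge
density with compact supports) ← `…StubRpClosure` (the limit argument and the stub).

This module: §0–§2 and §5, the vocabulary of the line VERBATIM from the registered skeleton (same namespace, so the
registered stub signatures elaborate unchanged): the package `CurvaturePackage`, the conclusion `DiagonalFrameRP`,
the box tori `TSite … texp`, the 45° cover `swapSite … CoverInsensitivity`, the statement `RPClosure`; then
(namespace `RpClosure`) the frame algebra of the proof — frame time `(R⁻¹x)⁰ = c (x⁰ − x¹)` and frame reflection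
`R⁻¹ ∘ swap₀₁ = θ ∘ R⁻¹` in a canonical frame `R e₀ = c (e₀ − e₁)`, `c² = 1/2`, and the reduction of every
diagonal frame `R e₀ = a e₀ + b e₁`, `a² = b² = 1/2`, to a canonical one by a proper sign flip
(`stub_rpClosure_frames`).  Everything about `R` goes through `R e₀` only.

References: Fröhlich–Israel–Lieb–Simon, Comm. Math. Phys. 62 (1978) Thm 2.1 (45° tori); Osterwalder–Schrader,
Comm. Math. Phys. 31 (1973) §2–3; Osterwalder–Seiler, Ann. Phys. 110 (1978) §2.
-/

set_option autoImplicit false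

noncomputable section

open scoped SchwartzMap ComplexConjugate InnerProductSpace
open MeasureTheory Filter Topology
open Literature.MathematicalPhysics.QuantumLattice Literature.MathematicalPhysics.AQFT
  Literature.MathematicalPhysics.QuantumFieldTheory

namespace Summit.QuantumFields.YangMills.Cruxes.DiagonalMirrorRPR.ParityBridgeColdTraces

/-! ## §0 Readback of the crux (verbatim package and conclusion, as in `Disproof.lean` §1) -/

/-- Euclidean `ℝ⁴`, time = coordinate `0`. -/
abbrev E4 : Type := EuclideanSpace ℝ (Fin 4)

section Package

variable {G : Type} [Group G] [TopologicalSpace G] [IsTopologicalGroup G] [CompactSpace G]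
  [MeasurableSpace G] [BorelSpace G]

/-- The curvature-channel package `W₁ r sch S₁` of the crux, verbatim. -/
def CurvaturePackage (r : LatticeRep G) (sch : SpeciesScheme (YMSpecies G)) (S₁ : SchwingerFamily E4) :
    Prop :=
  (∀ (n : ℕ), n ≠ 0 → ∀ (f : Fin n → 𝓢(E4, ℝ)) (F : 𝓢((Fin n → E4), ℂ)),
      IsTensorOf F (fun i => ofRealTest (f i)) → IsOffDiagonal F →
        Tendsto (fun k : ℕ => ((latticeSchwinger r.ρ sch (fun s => s.F) k n (fun _ => r.curvature) f : ℝ) : ℂ))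
          atTop (𝓝 (S₁ n F))) ∧
  (S₁.toLabelled.IsNormalized ∧ S₁.toLabelled.IsHermitian ∧ S₁.toLabelled.HasLinearGrowth ∧
    S₁.toLabelled.IsReflectionPositive ∧ S₁.toLabelled.IsSymmetric ∧ S₁.toLabelled.HasClusterProperty) ∧
  (∀ (n : ℕ) (a : E4) (F : 𝓢((Fin n → E4), ℂ)), IsOffDiagonal F → S₁ n (translateMulti a F) = S₁ n F) ∧
  (∀ (R : E4 ≃ₗᵢ[ℝ] E4), LinearMap.det (R.toLinearEquiv : E4 →ₗ[ℝ] E4) = 1 →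
    (∀ i : Fin 4, ∃ j : Fin 4, R (EuclideanSpace.single i 1) = EuclideanSpace.single j 1 ∨
      R (EuclideanSpace.single i 1) = -EuclideanSpace.single j 1) →
    ∀ (n : ℕ) (F : 𝓢((Fin n → E4), ℂ)), IsOffDiagonal F → S₁ n (linActMulti R F) = S₁ n F) ∧
  (∃ Δ : ℝ, 0 < Δ ∧ S₁.toLabelled.HasMassGap Δ ∧ HasLatticeMassGap r sch Δ)

end Package

/-- The conclusion of the crux: RP in pull-back form for every frame `R` with `R e₀ = a e₀ + b e₁`,
`a² = b² = 1/2`. -/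
def DiagonalFrameRP (S₁ : SchwingerFamily E4) : Prop :=
  ∀ (R : E4 ≃ₗᵢ[ℝ] E4) (a b : ℝ), a ^ 2 = 1 / 2 → b ^ 2 = 1 / 2 →
    R (EuclideanSpace.single 0 1) = a • EuclideanSpace.single 0 1 + b • EuclideanSpace.single 1 1 →
      (SchwingerFamily.toLabelled (fun n => (S₁ n).comp (linActMulti R))).IsReflectionPositive

/-! ## §1 Box tori with two free periods, optionally sheared (the 45° chart)

Sites `ZMod n₀ × ZMod n₁ × ZMod N × ZMod N`; steps `e₀ = (1,0,0,0)`, `e₂`, `e₃` standard and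
`e₁ = (0,1,0,0)` (`shear = false`: the box torus `ℤ_{n₀} × ℤ_{n₁} × ℤ_N²`) or `e₁ = (−1,1,0,0)`
(`shear = true`, `n₀ = 2N`, `n₁ = N`: the FILS 45° torus `T̃_N` in the chart `(u,w) = (x₀ − x₁, x₁)`,
since `⟨N(e₀+e₁), N(e₀−e₁), Ne₂, Ne₃⟩ ↦ 2Nℤ ⊕ Nℤ ⊕ Nℤ ⊕ Nℤ` under `x ↦ (x₀−x₁, x₁, x₂, x₃)`). -/

/-- Sites of the box torus. -/
abbrev TSite (n₀ n₁ N : ℕ) : Type := ZMod n₀ × ZMod n₁ × ZMod N × ZMod N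

/-- Positively oriented edges `(x, i)`: from `x` to `x + tstep i`. -/
abbrev TEdge (n₀ n₁ N : ℕ) : Type := TSite n₀ n₁ N × Fin 4

/-- Configurations: a group element per positively oriented edge. -/
abbrev TConfig (n₀ n₁ N : ℕ) (G : Type*) : Type _ := TEdge n₀ n₁ N → G

/-- `2N ≠ 0`. -/
instance neZero_two_mul (N : ℕ) [NeZero N] : NeZero (2 * N) := ⟨mul_ne_zero two_ne_zero (NeZero.ne N)⟩

section BoxTorus

variable {n₀ n₁ N : ℕ}

/-- Step vectors (`shear = true`: the `e₁`-tstep is `(−1, 1, 0, 0)`). -/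
def tstep (shear : Bool) (i : Fin 4) : TSite n₀ n₁ N :=
  ![((1 : ZMod n₀), (0 : ZMod n₁), (0 : ZMod N), (0 : ZMod N)),
    ((if shear then -1 else 0 : ZMod n₀), (1 : ZMod n₁), (0 : ZMod N), (0 : ZMod N)),
    ((0 : ZMod n₀), (0 : ZMod n₁), (1 : ZMod N), (0 : ZMod N)),
    ((0 : ZMod n₀), (0 : ZMod n₁), (0 : ZMod N), (1 : ZMod N))] i

variable {G : Type*} [Group G]

/-- Plaquette holonomy `U(x,i) U(x+eᵢ,j) U(x+eⱼ,i)⁻¹ U(x,j)⁻¹`. -/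
def tplaq (shear : Bool) (U : TConfig n₀ n₁ N G) (x : TSite n₀ n₁ N) (i j : Fin 4) : G :=
  U (x, i) * U (x + tstep shear i, j) * (U (x + tstep shear j, i))⁻¹ * (U (x, j))⁻¹

variable {Nc : ℕ} (ρ : G →* Matrix (Fin Nc) (Fin Nc) ℂ)

/-- Wilson's action `∑ₓ ∑_{i<j} Re tr ρ(U_p)` (tree normalisation of `wilsonMeasure`, up to the constant). -/
def taction [NeZero n₀] [NeZero n₁] [NeZero N] (shear : Bool) (U : TConfig n₀ n₁ N G) : ℝ :=
  ∑ x : TSite n₀ n₁ N, ∑ i : Fin 4, ∑ j : Fin 4,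
    if i < j then (ρ (tplaq shear U x i j)).trace.re else 0

/-- Boltzmann weight `exp(β · action)`. -/
def tweight [NeZero n₀] [NeZero n₁] [NeZero N] (β : ℝ) (shear : Bool) (U : TConfig n₀ n₁ N G) : ℝ :=
  Real.exp (β * taction ρ shear U)

variable [TopologicalSpace G] [IsTopologicalGroup G] [CompactSpace G] [MeasurableSpace G] [BorelSpace G]

/-- Product of normalised Haar measures over the edges. -/
def thaar (n₀ n₁ N : ℕ) [NeZero n₀] [NeZero n₁] [NeZero N] : Measure (TConfig n₀ n₁ N G) :=
  Measure.pi fun _ : TEdge n₀ n₁ N => haarProbability G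

/-- Partition function `Z = ∫ exp(β · action) dHaar`. -/
def tZ (n₀ n₁ N : ℕ) [NeZero n₀] [NeZero n₁] [NeZero N] (β : ℝ) (shear : Bool) : ℝ :=
  ∫ U, tweight ρ β shear U ∂(thaar n₀ n₁ N : Measure (TConfig n₀ n₁ N G))

/-- Normalised (complex) expectation `⟨F⟩ = Z⁻¹ ∫ F exp(β · action) dHaar`. -/
def texp [NeZero n₀] [NeZero n₁] [NeZero N] (β : ℝ) (shear : Bool) (F : TConfig n₀ n₁ N G → ℂ) : ℂ :=
  (∫ U, F U * ((tweight ρ β shear U : ℝ) : ℂ) ∂(thaar n₀ n₁ N : Measure (TConfig n₀ n₁ N G))) /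
    ((tZ ρ n₀ n₁ N β shear : ℝ) : ℂ)

end BoxTorus

/-! ## §2 The 45° torus `T̃_N` (`n₀ = 2N`, `n₁ = N`, sheared) and its swap reflection -/

section Cover

variable {N : ℕ} [NeZero N]

/-- The swap `x₀ ↔ x₁` in the chart `(u,w)`: `(u, w, y, z) ↦ (−u, w + ū, y, z)`, `ū = u mod N`. It fixes the
site layers `u = 0` and `u = N` pointwise and exchanges the steps `e₀ = (1,0,0,0)` and `e₁ = (−1,1,0,0)`. -/
def swapSite (x : TSite (2 * N) N N) : TSite (2 * N) N N :=
  (-x.1, x.2.1 + ZMod.castHom (dvd_mul_left N 2) (ZMod N) x.1, x.2.2.1, x.2.2.2)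

/-- The induced map on positively oriented edges (orientation preserved): `(x, i) ↦ (θx, σ i)`, `σ = (0 1)`. -/
def swapEdge (e : TEdge (2 * N) N N) : TEdge (2 * N) N N :=
  (swapSite e.1, Equiv.swap (0 : Fin 4) 1 e.2)

/-- The swap on configurations, `θ^*U = U ∘ swapEdge`. -/
def swapConfig {G : Type*} (U : TConfig (2 * N) N N G) : TConfig (2 * N) N N G := U ∘ swapEdge

/-- Edges of the CLOSED positive half `0 ≤ u ≤ N` (both endpoints between the two mirror layers). -/
def posEdges (N : ℕ) [NeZero N] : Set (TEdge (2 * N) N N) :=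
  {e | (e.1.1).val ≤ N ∧ ((e.1 + tstep true e.2).1).val ≤ N}

variable {G : Type} [Group G] [TopologicalSpace G] [IsTopologicalGroup G] [CompactSpace G]
  [MeasurableSpace G] [BorelSpace G] {Nc : ℕ}

/-- **Swap-RP of Wilson's measure on `T̃_N` at `(ρ, β)`**: for every bounded measurable `F` depending only on
the edges of the closed positive half, `⟨conj(F ∘ θ^*) · F⟩ ≥ 0` (real and non-negative). -/
def CoverSwapRPAt (ρ : G →* Matrix (Fin Nc) (Fin Nc) ℂ) (β : ℝ) (N : ℕ) [NeZero N] : Prop :=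
  ∀ F : TConfig (2 * N) N N G → ℂ, Measurable F → (∃ C : ℝ, ∀ U, ‖F U‖ ≤ C) →
    DependsOn F (posEdges N) →
      0 ≤ (texp ρ β true fun U => conj (F (swapConfig U)) * F U).re ∧
        (texp ρ β true fun U => conj (F (swapConfig U)) * F U).im = 0

/-- Reduction of `ℤ⁴` modulo `Λ̃_N = ⟨N(e₀+e₁), N(e₀−e₁), Ne₂, Ne₃⟩`, in the chart `(u,w) = (x₀−x₁, x₁)`:
a group homomorphism `ℤ⁴ → ℤ_{2N} × ℤ_N × ℤ_N²` with kernel `Λ̃_N`, `e₀ ↦ (1,0,0,0)`, `e₁ ↦ (−1,1,0,0)`. -/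
def skewProj (N : ℕ) (x : Fin 4 → ℤ) : TSite (2 * N) N N :=
  (((x 0 - x 1 : ℤ) : ZMod (2 * N)), ((x 1 : ℤ) : ZMod N), ((x 2 : ℤ) : ZMod N), ((x 3 : ℤ) : ZMod N))

/-- The `Λ̃_N`-periodic lift of a cover configuration to a configuration of `ℤ⁴` (the analogue of
`torusLift`). -/
def skewLift (N : ℕ) (U : TConfig (2 * N) N N G) : LGConfig 4 G := fun e => U (skewProj N e.1, e.2)

/-- The curvature-string `n`-point function at tstep `k` computed on the 2:1 COVER `T̃_{N_k}` (`N_k = sch.side k`)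
with the scheme's spacing, coupling and renormalisations — `latticeSchwinger` with the odd torus replaced by
its 45° double cover (same smearing box `[-L_k, L_k]⁴ ⊂ ℤ⁴`, same `a_k, c_k, m_k`). -/
def coverSchwinger (r : LatticeRep G) (sch : SpeciesScheme (YMSpecies G)) (k n : ℕ)
    (f : Fin n → 𝓢(E4, ℝ)) : ℝ :=
  (texp r.ρ (sch.β k) true fun U : TConfig (2 * sch.side k) (sch.side k) (sch.side k) G =>
    ((∏ i, smearedLatticeField r.curvature.F (Literature.Probability.LatticeModels.box 4 (sch.L k))
        (sch.a k) (sch.c r.curvature k) (sch.m r.curvature k) (f i) (skewLift (sch.side k) U) : ℝ) : ℂ)).re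

/-- **Cover insensitivity** of the scheme: for compactly supported real test functions the curvature strings
computed on the statement's torus `ℤ⁴/N_kℤ⁴` and on its 45° double cover have the same limit behaviour
(difference `→ 0`). -/
def CoverInsensitivity (r : LatticeRep G) (sch : SpeciesScheme (YMSpecies G)) : Prop :=
  ∀ (n : ℕ), n ≠ 0 → ∀ (f : Fin n → 𝓢(E4, ℝ)), (∀ i, HasCompactSupport (f i)) →
    Tendsto (fun k : ℕ => latticeSchwinger r.ρ sch (fun s => s.F) k n (fun _ => r.curvature) f -
      coverSchwinger r sch k n f) atTop (𝓝 0)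

end Cover

/-! ## §5 The registered stub statement -/

/-- Statement of `stub_rpClosure`. -/
def RPClosure : Prop :=
  ∀ (G : Type) [Group G] [TopologicalSpace G] [IsTopologicalGroup G] [CompactSpace G]
    [MeasurableSpace G] [BorelSpace G], IsCompactSimpleLieGroup G →
    ∀ (r : LatticeRep G) (sch : SpeciesScheme (YMSpecies G)) (S₁ : SchwingerFamily E4),
      CurvaturePackage r sch S₁ → (∀ k, 0 ≤ sch.β k) →
        (∀ k, 2 ≤ sch.side k → CoverSwapRPAt r.ρ (sch.β k) (sch.side k)) →
          CoverInsensitivity r sch → DiagonalFrameRP S₁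

/-! # Proof material (sub-namespace `RpClosure`, no clash with the sibling stub files of the line) -/

namespace RpClosure
/-! ## §F Frames: the swap of `ℝ⁴`, frame time and frame reflection -/

section Frame

/-- The unit vector `e_i` of `ℝ⁴`. -/
abbrev ee (i : Fin 4) : E4 := EuclideanSpace.single i 1

/-- The coordinate swap `x₀ ↔ x₁` of `ℝ⁴`, as a plain function. -/
def swap01 (y : E4) : E4 := WithLp.toLp 2 fun i => y (Equiv.swap (0 : Fin 4) 1 i)

variable {R : E4 ≃ₗᵢ[ℝ] E4} {c : ℝ}

/-- Frame time: `(R⁻¹ p)⁰ = ⟨p, R e₀⟩ = c (p⁰ − p¹)` when `R e₀ = c (e₀ − e₁)`. -/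
theorem frame_time (hR : R (ee 0) = c • ee 0 + (-c) • ee 1) (p : E4) :
    (R.symm p) 0 = c * (p 0 - p 1) := by
  -- adapted from `Phantom.frame_time` (Theorems/DiagonalMirrorRPR/Negative/PhantomFunctional)
  have h1 : (R.symm p) 0 = ⟪R.symm p, ee 0⟫_ℝ := by rw [EuclideanSpace.inner_single_right]; simp
  rw [h1, LinearIsometryEquiv.inner_map_eq_flip, LinearIsometryEquiv.symm_symm, hR, inner_add_right,
    inner_smul_right, inner_smul_right, EuclideanSpace.inner_single_right, EuclideanSpace.inner_single_right]
  simp; ring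

/-- The time reflection as `z ↦ z − 2 z⁰ e₀`. -/
theorem timeReflection_eq_sub (z : E4) : timeReflection 4 z = z - (2 * z 0) • ee 0 := by
  ext i
  rw [timeReflection_apply]
  by_cases hi : i = 0
  · subst hi; simp; ring
  · simp [hi]

/-- Frame reflection: `R⁻¹ ∘ swap = θ ∘ R⁻¹` when `R e₀ = c (e₀ − e₁)`, `c² = 1/2` (the frame reflection
`R θ R⁻¹` across `(R e₀)^⊥` is the swap `x₀ ↔ x₁`). -/
theorem frame_reflection (hR : R (ee 0) = c • ee 0 + (-c) • ee 1) (hc : c ^ 2 = 1 / 2) (y : E4) :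
    R.symm (swap01 y) = timeReflection 4 (R.symm y) := by
  apply R.injective
  rw [LinearIsometryEquiv.apply_symm_apply, timeReflection_eq_sub, map_sub, map_smul,
    LinearIsometryEquiv.apply_symm_apply, hR, frame_time hR]
  have h2 : 2 * (c * (y 0 - y 1)) = (y 0 - y 1) * (2 * c) := by ring
  have hc2 : (2 * c) * c = 1 := by nlinarith
  have hc3 : (2 * c) * -c = -1 := by rw [mul_neg, hc2]
  rw [h2, mul_smul, smul_add, smul_smul, smul_smul, hc2, hc3, neg_smul, one_smul]
  ext i
  fin_cases i <;> simp [swap01, Equiv.swap_apply_def]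

end Frame


/-! ## §I Proper sign flips and the normal form of a diagonal frame -/

section Frames

/-- Sign flip of the coordinates in `s ⊆ {0,1,2,3}`, a linear isometry of `ℝ⁴`. -/
def signFlip (s : Finset (Fin 4)) : E4 ≃ₗᵢ[ℝ] E4 :=
  LinearIsometryEquiv.piLpCongrRight 2 fun i : Fin 4 =>
    if i ∈ s then LinearIsometryEquiv.neg ℝ else LinearIsometryEquiv.refl ℝ ℝ

/-- Coordinates of a sign flip. -/
theorem signFlip_apply (s : Finset (Fin 4)) (x : E4) (i : Fin 4) :
    signFlip s x i = if i ∈ s then -x i else x i := by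
  -- adapted from `timeReflection_apply` (Literature/QuantumLattice/EuclideanAction)
  simp only [signFlip, LinearIsometryEquiv.piLpCongrRight_apply, PiLp.toLp_apply]
  split_ifs <;> rfl

/-- A sign flip is a signed permutation (with trivial permutation). -/
theorem signFlip_single (s : Finset (Fin 4)) (i : Fin 4) :
    signFlip s (ee i) = if i ∈ s then -ee i else ee i := by
  ext j
  rw [signFlip_apply]
  by_cases hj : j = i
  · subst hj; split_ifs <;> simp
  · split_ifs <;> simp [hj]

/-- The determinant of a sign flip is `(−1)^{|s|}`. -/
theorem det_signFlip (s : Finset (Fin 4)) :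
    LinearMap.det ((signFlip s).toLinearEquiv : E4 →ₗ[ℝ] E4) = ∏ i, (if i ∈ s then (-1 : ℝ) else 1) := by
  classical
  rw [← LinearMap.det_toMatrix (PiLp.basisFun 2 ℝ (Fin 4))]
  have h : LinearMap.toMatrix (PiLp.basisFun 2 ℝ (Fin 4)) (PiLp.basisFun 2 ℝ (Fin 4))
      ((signFlip s).toLinearEquiv : E4 →ₗ[ℝ] E4) = Matrix.diagonal fun i => if i ∈ s then (-1 : ℝ) else 1 := by
    ext i j
    rw [LinearMap.toMatrix_apply, PiLp.basisFun_repr, PiLp.basisFun_apply, Matrix.diagonal_apply]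
    simp only [LinearEquiv.coe_coe, LinearIsometryEquiv.coe_toLinearEquiv]
    rw [signFlip_apply s (PiLp.single 2 j (1 : ℝ)) i]
    simp only [PiLp.single_apply]
    by_cases hij : i = j
    · subst hij; split_ifs <;> simp
    · have hji : j ≠ i := fun h => hij h.symm
      split_ifs <;> simp
  rw [h, Matrix.det_diagonal]

/-- **Normal form of a diagonal frame.** If `R e₀ = a e₀ + b e₁` with `a² = b² = 1/2`, a proper sign flip `P`
(a signed permutation of determinant `1`) brings the frame to `(P ∘ R) e₀ = c (e₀ − e₁)`, `c = 1/√2 > 0`. -/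
theorem frame_normal_form {R : E4 ≃ₗᵢ[ℝ] E4} {a b : ℝ} (ha : a ^ 2 = 1 / 2) (hb : b ^ 2 = 1 / 2)
    (hR : R (ee 0) = a • ee 0 + b • ee 1) :
    ∃ (P : E4 ≃ₗᵢ[ℝ] E4) (c : ℝ), c ^ 2 = 1 / 2 ∧ 0 < c ∧
      LinearMap.det (P.toLinearEquiv : E4 →ₗ[ℝ] E4) = 1 ∧
      (∀ i : Fin 4, ∃ j : Fin 4, P (ee i) = ee j ∨ P (ee i) = -ee j) ∧
      (R.trans P) (ee 0) = c • ee 0 + (-c) • ee 1 := by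
  set c : ℝ := Real.sqrt (1 / 2) with hc_def
  have hc : c ^ 2 = 1 / 2 := Real.sq_sqrt (by norm_num)
  have hc0 : 0 < c := Real.sqrt_pos.2 (by norm_num)
  have ha' : a = c ∨ a = -c := sq_eq_sq_iff_eq_or_eq_neg.1 (by rw [ha, hc])
  have hb' : b = c ∨ b = -c := sq_eq_sq_iff_eq_or_eq_neg.1 (by rw [hb, hc])
  have hsigned : ∀ s : Finset (Fin 4), ∀ i : Fin 4, ∃ j : Fin 4,
      signFlip s (ee i) = ee j ∨ signFlip s (ee i) = -ee j := fun s i =>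
    ⟨i, by rw [signFlip_single]; split_ifs <;> simp⟩
  have hframe : ∀ s : Finset (Fin 4), (R.trans (signFlip s)) (ee 0) =
      a • (if (0 : Fin 4) ∈ s then -ee 0 else ee 0) + b • (if (1 : Fin 4) ∈ s then -ee 1 else ee 1) := fun s => by
    rw [LinearIsometryEquiv.trans_apply, hR, map_add, map_smul, map_smul, signFlip_single, signFlip_single]
  rcases ha' with rfl | rfl <;> rcases hb' with rfl | rfl
  · refine ⟨signFlip {1, 2}, c, hc, hc0, ?_, hsigned _, ?_⟩
    · rw [det_signFlip]; simp [Fin.prod_univ_four]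
    · rw [hframe]; simp [smul_neg, neg_smul]
  · refine ⟨signFlip ∅, c, hc, hc0, ?_, hsigned _, ?_⟩
    · rw [det_signFlip]; simp
    · rw [hframe]; simp [neg_smul]
  · refine ⟨signFlip {0, 1}, c, hc, hc0, ?_, hsigned _, ?_⟩
    · rw [det_signFlip]; simp [Fin.prod_univ_four]
    · rw [hframe]; simp [smul_neg, neg_smul]
  · refine ⟨signFlip {0, 2}, c, hc, hc0, ?_, hsigned _, ?_⟩
    · rw [det_signFlip]; simp [Fin.prod_univ_four]
    · rw [hframe]; simp [smul_neg, neg_smul]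

end Frames


/-- **Sub-goal `stub_rpClosure_frames` of `stub_rpClosure` (frame normal form).** A diagonal frame
`R e₀ = a e₀ + b e₁`, `a² = b² = 1/2`, is brought to the canonical frame `(P ∘ R) e₀ = c (e₀ − e₁)`, `c = 1/√2`,
by a proper sign flip `P` (a signed permutation of determinant `1`, as in the `W(B₄)`-clause of `W₁`). -/
theorem stub_rpClosure_frames :
    ∀ {R : E4 ≃ₗᵢ[ℝ] E4} {a b : ℝ}, a ^ 2 = 1 / 2 → b ^ 2 = 1 / 2 → R (ee 0) = a • ee 0 + b • ee 1 →
      ∃ (P : E4 ≃ₗᵢ[ℝ] E4) (c : ℝ), c ^ 2 = 1 / 2 ∧ 0 < c ∧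
        LinearMap.det (P.toLinearEquiv : E4 →ₗ[ℝ] E4) = 1 ∧
        (∀ i : Fin 4, ∃ j : Fin 4, P (ee i) = ee j ∨ P (ee i) = -ee j) ∧
        (R.trans P) (ee 0) = c • ee 0 + (-c) • ee 1 :=
  fun ha hb hR => frame_normal_form ha hb hR

end RpClosure

end Summit.QuantumFields.YangMills.Cruxes.DiagonalMirrorRPR.ParityBridgeColdTraces

end
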